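import Summits.SmoothPoincare4.SmoothPoincare4.Theorems.EntropyRungNoncompactShrinkerGapHeatMaxPrinciple
import HarnessLib

/-!
# Two-sided bounds `inf ρ₀ ≤ ρ ≤ sup ρ₀` along the weighted heat flow on a complete weighted
# manifold (crux `EntropyRung.NoncompactShrinkerGap`, stmt-SmoothPoincare4-10868,
# line `collapsed-ends-usc`, skeleton v13)

Registered helper `helper_twoSidedBound`. Setting as in
`EntropyRungNoncompactShrinkerGapHeatMaxPrinciple.lean` (`M` modelled on `ℝⁿ`, `g` Riemannian,
`V` smooth with `e^{-V} ∈ L¹(M)`, `L = Δ_g − g⁻¹(dV, d·)`, cut-offs `η_k` with `|Lη_k| ≤ C`).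
**Theorem.** A solution `ρ` of `∂ₛρ = Lρ` on `[0, T]`, smooth on `M × O` (`O ⊇ [0,T]` open), with
`c₁ ≤ ρ(0) ≤ C₁`, `c₁ ≤ c₀ ≤ C₁` and `(ρ − c₀)² e^{-V} ∈ L¹(M × (0,T))` satisfies `c₁ ≤ ρ ≤ C₁` on
`[0, T] × M`.

Proof: for constants `a, b` the affine image `z = aρ + b` is smooth on `M × O` and solves
`∂ₛz = Lz` (`L(aρ + b) = aLρ`, `weightedLaplacian_affine`); for `(a, b) = (1, −C₁)` and `(−1, c₁)`
one has `z(0) ≤ 0` and `z ≤ |ρ − c₀| ≤ (ρ − c₀)² + 1`, so `z₊ e^{-V}` is dominated by the integrable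
`(ρ − c₀)² e^{-V} + e^{-V}` on the strip (`e^{-V} ⊗ 1` is integrable on `M × (0,T)`), and `z ≤ 0` by
`helper_weightedMaxPrinciple`. (Closed case: `heatFlow_ge_of_ge` / `heatFlow_le_of_le` of
`WeightedHeatFlowAPriori.lean` via Topping's weak maximum principle.)
-/

noncomputable section

set_option linter.dupNamespace false

open scoped Manifold ContDiff ENNReal NNReal Topology
open MeasureTheory Set Filter
open Literature.Geometry.Lorentzian Literature.Geometry.Riemannian

namespace Summit.SmoothPoincare4.SmoothPoincare4.Theorems.NoncompactShrinkerGapHeat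

/-! ### Two-sided bounds along the weighted heat flow on a complete manifold -/

/-- **Two-sided bounds `inf ρ₀ ≤ ρ ≤ sup ρ₀` along the weighted heat flow on a complete weighted
manifold** (registered helper `helper_twoSidedBound` of line `collapsed-ends-usc`): for a solution
`ρ` of `∂ₛρ = Lρ` on `[0, T]` with `c₁ ≤ ρ(0) ≤ C₁`, `c₁ ≤ c₀ ≤ C₁`, `(ρ − c₀)² e^{-V}` integrable
on the strip and `e^{-V} ∈ L¹(M)`, both `z = ρ − C₁` and `z = c₁ − ρ` are (sub)solutions
(`L(aρ + b) = aLρ`) with `z(0) ≤ 0` and `z₊ ≤ |ρ − c₀| ≤ (ρ − c₀)² + 1`, so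
`z₊ e^{-V} ∈ L¹(M × (0,T))` and `z ≤ 0` by the weak maximum principle
`helper_weightedMaxPrinciple`. The closed case is `heatFlow_ge_of_ge` / `heatFlow_le_of_le`
(`WeightedHeatFlowAPriori.lean`). [cite: Grigoryan2009, §11.4 and §12.1
(uniqueness class / maximum principle for the Cauchy problem on complete weighted manifolds)] -/
theorem helper_twoSidedBound : ∀ (n : ℕ) (M : Type*) [TopologicalSpace M] [T2Space M] [SecondCountableTopology M] [ChartedSpace (EuclideanSpace ℝ (Fin n)) M] [IsManifold (𝓡 n) ∞ M] [T3Space M] [MeasurableSpace M] [BorelSpace M] (g : PseudoRiemannianMetric (𝓡 n) ∞ (EuclideanSpace ℝ (Fin n)) (TangentSpace (𝓡 n) : M → Type _)) [g.HasLeviCivita] (V : M → ℝ), g.IsRiemannian → ContMDiff (𝓡 n) 𝓘(ℝ, ℝ) ∞ V → Integrable (fun x ↦ Real.exp (-V x)) g.riemVolume → ∀ (η : ℕ → M → ℝ) (C : ℝ), (∀ k, ContMDiff (𝓡 n) 𝓘(ℝ, ℝ) ∞ (η k)) → (∀ k, HasCompactSupport (η k)) → (∀ k x, 0 ≤ η k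 x ∧ η k x ≤ 1) → (∀ k x, η k x ≤ η (k + 1) x) → (∀ x, ∀ᶠ k in atTop, ∀ᶠ y in 𝓝 x, η k y = 1) → (∀ k x, |g.dalembertian (η k) x - g.innerDual x (mvfderiv (𝓡 n) V x).toLinearMap (mvfderiv (𝓡 n) (η k) x).toLinearMap| ≤ C) → ∀ (T : ℝ) (O : Set ℝ) (ρ : ℝ → M → ℝ), 0 < T → IsOpen O → Icc 0 T ⊆ O → ContMDiffOn ((𝓡 n).prod 𝓘(ℝ, ℝ)) 𝓘(ℝ, ℝ) ∞ (fun p : M × ℝ ↦ ρ p.2 p.1) (univ ×ˢ O) → (∀ s ∈ Icc 0 T, ∀ x, deriv (fun r ↦ ρ r x) s = g.dalembertian (ρ s) x - g.innerDual x (mvfderiv (𝓡 n) V x).toLinearMap (mvfderiv (𝓡 n) (ρ s) x).toLinearMap) → ∀ (c₀ c₁ C₁ : ℝ), c₁ ≤ c₀ → c₀ ≤ C₁ → (∀ x, c₁ ≤ ρ 0 x ∧ ρ 0 x ≤ C₁) → Integrable (fun p : M × ℝ ↦ (ρ p.2 p.1 - c₀) ^ 2 * Real.exp (-V p.1)) ((g.riemVolume.prod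 (volume : Measure ℝ)).restrict (univ ×ˢ Ioo 0 T)) → ∀ s ∈ Icc 0 T, ∀ x, c₁ ≤ ρ s x ∧ ρ s x ≤ C₁ := by
  intro n M _ _ _ _ _ _ _ _ g _ V hg hV hfin η C hηs hηc hη01 hηmono hη1 hLη T O ρ hT hO hTO hρ heq
    c₀ c₁ C₁ hc₁ hC₁ hρ0 hint s hs x
  -- measure-theoretic preliminaries
  haveI : LocallyCompactSpace M := Manifold.locallyCompact_of_finiteDimensional (M := M) (𝓡 n)
  haveI : IsFiniteMeasureOnCompacts g.riemVolume :=
    CarrilloNi2009_shrinkerLSI.isFiniteMeasureOnCompacts_riemVolume hg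
  haveI : IsLocallyFiniteMeasure g.riemVolume := isLocallyFiniteMeasure_of_isFiniteMeasureOnCompacts
  set μ : Measure M := g.riemVolume with hμ
  set ν : Measure (M × ℝ) := (μ.prod (volume : Measure ℝ)).restrict (univ ×ˢ Ioo 0 T) with hν
  have hνeq : ν = μ.prod ((volume : Measure ℝ).restrict (Ioo 0 T)) := by
    rw [hν, ← Measure.prod_restrict, Measure.restrict_univ]
  have hexpc : Continuous fun y ↦ Real.exp (-V y) := Real.continuous_exp.comp hV.continuous.neg
  have hexp_strip : Integrable (fun p : M × ℝ ↦ Real.exp (-V p.1)) ν := by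
    rw [hνeq]
    have h := hfin.mul_prod (integrable_const (1 : ℝ) :
      Integrable (fun _ : ℝ ↦ (1 : ℝ)) ((volume : Measure ℝ).restrict (Ioo 0 T)))
    simpa using h
  have hbound : Integrable (fun p : M × ℝ ↦ (ρ p.2 p.1 - c₀) ^ 2 * Real.exp (-V p.1) +
      Real.exp (-V p.1)) ν := hint.add hexp_strip
  -- regularity of `ρ`
  have hρs : ∀ r ∈ O, ContMDiff (𝓡 n) 𝓘(ℝ, ℝ) ∞ (ρ r) := fun r hr ↦
    contMDiff_slice_of_contMDiffOn hρ hr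
  have hρd : ∀ r ∈ O, ∀ y, HasDerivAt (fun r' ↦ ρ r' y) (deriv (fun r' ↦ ρ r' y) r) r := by
    intro r hr y
    have h := hasDerivWithinAt_time_of_contMDiffOn (I := 𝓡 n) (k := ∞) (by simp) hρ y hr
    exact (h.hasDerivAt (hO.mem_nhds hr)).differentiableAt.hasDerivAt
  -- the maximum principle for the affine images `a ρ + b`
  have key : ∀ a b : ℝ, (∀ y, a * ρ 0 y + b ≤ 0) → (∀ r y, a * ρ r y + b ≤ |ρ r y - c₀|) →
      a * ρ s x + b ≤ 0 := by
    intro a b h0 hle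
    set z : ℝ → M → ℝ := fun r y ↦ a * ρ r y + b with hz
    have hzs : ContMDiffOn ((𝓡 n).prod 𝓘(ℝ, ℝ)) 𝓘(ℝ, ℝ) ∞ (fun p : M × ℝ ↦ z p.2 p.1)
        (univ ×ˢ O) := (contMDiffOn_const.mul hρ).add contMDiffOn_const
    have hsub : ∀ r ∈ Icc 0 T, ∀ y, deriv (fun r' ↦ z r' y) r ≤ g.dalembertian (z r) y -
        g.innerDual y (mvfderiv (𝓡 n) V y).toLinearMap (mvfderiv (𝓡 n) (z r) y).toLinearMap := by
      intro r hr y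
      have hrO := hTO hr
      have hd : HasDerivAt (fun r' ↦ z r' y) (a * deriv (fun r' ↦ ρ r' y) r) r :=
        ((hρd r hrO y).const_mul a).add_const b
      have h2 : ContMDiffAt (𝓡 n) 𝓘(ℝ, ℝ) 2 (ρ r) y :=
        ((hρs r hrO).of_le (WithTop.coe_le_coe.mpr le_top)).contMDiffAt
      have hLz := weightedLaplacian_affine (g := g) (V := V) h2 a b
      rw [hd.deriv, show z r = fun y' ↦ a * ρ r y' + b from rfl, hLz, heq r hr y]
    have hint' : Integrable (fun p : M × ℝ ↦ max (z p.2 p.1) 0 * Real.exp (-V p.1)) ν := by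
      refine hbound.mono' ?_ (ae_of_all _ fun p ↦ ?_)
      · have hcont : ContinuousOn (fun p : M × ℝ ↦ max (z p.2 p.1) 0 * Real.exp (-V p.1))
            (univ ×ˢ O) :=
          (hzs.continuousOn.sup continuousOn_const).mul (hexpc.comp continuous_fst).continuousOn
        exact (hcont.mono (prod_mono le_rfl (Ioo_subset_Icc_self.trans hTO))).aestronglyMeasurable
          (MeasurableSet.univ.prod measurableSet_Ioo)
      · have hex := Real.exp_pos (-V p.1)
        have h1 : max (z p.2 p.1) 0 ≤ |ρ p.2 p.1 - c₀| := max_le (hle _ _) (abs_nonneg _)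
        have h2 : |ρ p.2 p.1 - c₀| ≤ (ρ p.2 p.1 - c₀) ^ 2 + 1 := by
          nlinarith [abs_nonneg (ρ p.2 p.1 - c₀), sq_abs (ρ p.2 p.1 - c₀)]
        rw [Real.norm_eq_abs, abs_of_nonneg (mul_nonneg (le_max_right _ _) hex.le)]
        nlinarith
    exact helper_weightedMaxPrinciple n M g V hg hV η C hηs hηc hη01 hηmono hη1 hLη T O z hT hO hTO
      hzs hsub h0 hint' s hs x
  refine ⟨?_, ?_⟩
  · have h := key (-1) c₁ (fun y ↦ by linarith [(hρ0 y).1])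
      (fun r y ↦ by linarith [neg_abs_le (ρ r y - c₀)])
    linarith
  · have h := key 1 (-C₁) (fun y ↦ by linarith [(hρ0 y).2])
      (fun r y ↦ by linarith [le_abs_self (ρ r y - c₀)])
    linarith

end Summit.SmoothPoincare4.SmoothPoincare4.Theorems.NoncompactShrinkerGapHeat

end
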